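import Summits.QuantumFields.YangMills.Theorems.FluctuationComparisonRegPrIntLS1aCentreLegResponse
import HarnessLib

/-!
# Route `UnitScaleTilt`, crux K1b-INT `FluctuationComparisonRegPrIntL` (stmt-QuantumFields-20520) — S1aᴴ `RunClassMembershipH`, conjuncts (a)∕(c):
# THE CENTRE-LEG LAW IS INVERSE-LIPSCHITZ NEAR THE IDENTITY — `‖g′g⁻¹ − 1‖ ≤ (2∕κ)·‖Ū(g′)Ū(g)* − 1‖`; in particular it is INJECTIVE there

Cell `ym3-torus` (rung R3: SU(2) YM₃ on T³ — NOT d = 4, NOT infinite volume, NOT a mass gap, NOT Clay), width seat `ym3-torus-px13` g24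
(helper on the crux, `--supports stmt-QuantumFields-20520`, def-free).  FILE 3 of the centre-leg series (✓`…S1aCentreLegOccurrence`,
✓`…S1aCentreLegResponse`, `…S1aCentreLegSurjective`): with FILE 2's robust local surjectivity this makes the one-variable law
`g ↦ K(g) := Ū(update U₀ e′ (g·U₀e′))(c)` of the centre leg `e′ = ⟨emb c₋, ν⟩` a quantitative LOCAL HOMEOMORPHISM near `g = 1`, uniformly over
all small-field backgrounds `U₀` — the non-private analogue of the private laws' (FIB) of ✓`…OneStepSubmersion`, as the transversality lemma
(T⊥) of UV3-NODE §67.7–§67.9 at small fields consumes it (px13 g24 cost map ∕ UV3-NODE §77).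

THE MATHEMATICS ([folklore]; the only input is FILE B's specialisation of [Balaban1985Averaging] Prop. 3 (122)–(124) at a background).  At the
moved background `U_g` (loop variables within `α + dist1 g`, FILE A) the perturbation `h := g′·g⁻¹` gives `K(g′)K(g)* − 1 = κ•(h − 1) + E`,
`‖E‖ ≤ 400ℓ‖h − 1‖(ℓ‖h − 1‖ + α + dist1 g)`; hence `(κ − 400ℓ(ℓ‖h−1‖ + α + dist1 g))·‖h − 1‖ ≤ ‖K(g′)K(g)* − 1‖`, and under
`800ℓ(ℓ‖h − 1‖ + α + dist1 g) ≤ κ` the factor is `≥ κ∕2`.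

WHAT THIS FILE PROVES (`SU(N)`, any `Params` in the standing range):
* `norm_mul_inv_sub_one` — `‖g′g⁻¹ − 1‖ = ‖g′ − g‖` for unitaries.
* ★★ `centreLeg_inverse_lipschitz` — `‖g′·g⁻¹ − 1‖ ≤ (2∕κ)·‖K(g′)·K(g)* − 1‖` under `α + dist1 g ≤ 1∕24`, `48ℓ‖g′g⁻¹ − 1‖ ≤ 1`,
  `2ℓ‖g′g⁻¹ − 1‖ + α + dist1 g < δ_N`, `800ℓ(ℓ‖g′g⁻¹ − 1‖ + α + dist1 g) ≤ κ`.
* ★ `centreLeg_injective` — under the same smallness, `K(g′) = K(g) → g′ = g`.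

HONEST SCOPE.  Two inequalities over a landed letter; nothing of Bałaban's beyond the cited tree theorem; (T⊥), S1aᴴ, the five registered stubs,
crux 20520 and `YM3TorusSU2` are NOT proved; the Yang–Mills mass gap is NOT proved.
-/

set_option autoImplicit false

noncomputable section

open scoped Matrix.Norms.L2Operator

namespace Summit.QuantumFields.YangMills.Theorems.FluctuationComparisonRegPrIntLS1aCentreLegInverseLipschitz

open Literature.MathematicalPhysics.QuantumFieldTheory.Balaban1983to89
open T4Continuum AveragingRT BlockAveraging ExpMeanLog
open Summit.QuantumFields.YangMills.Theorems.FluctuationComparisonRegPrIntLS1aCentreLegOccurrence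
open Summit.QuantumFields.YangMills.Theorems.FluctuationComparisonRegPrIntLS1aCentreLegResponse

variable {n : Type*} [Fintype n] [DecidableEq n] {P : Params} {j : ℕ} [DecidableEq (PBond P j)]

omit [DecidableEq (PBond P j)] in
/-- For `g, g′ ∈ SU(N)`: `‖g′·g⁻¹ − 1‖ = ‖g′ − g‖` (right multiplication by a unitary is an isometry). [folklore] -/
theorem norm_mul_inv_sub_one [Nonempty n] (g g' : Matrix.specialUnitaryGroup n ℂ) :
    ‖(((g' * g⁻¹ : Matrix.specialUnitaryGroup n ℂ)) : Matrix n n ℂ) - 1‖ = ‖(g' : Matrix n n ℂ) - (g : Matrix n n ℂ)‖ := by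
  have hgu : (g : Matrix n n ℂ) ∈ Matrix.unitaryGroup n ℂ := (Matrix.mem_specialUnitaryGroup_iff.1 g.2).1
  have h1 : (((g' * g⁻¹ : Matrix.specialUnitaryGroup n ℂ)) : Matrix n n ℂ) - 1 =
      ((g' : Matrix n n ℂ) - (g : Matrix n n ℂ)) * star (g : Matrix n n ℂ) := by
    rw [Submonoid.coe_mul, sub_mul, Unitary.mul_star_self_of_mem hgu]; rfl
  rw [h1]
  -- `‖X · g*‖ = ‖X‖`
  apply le_antisymm
  · calc _ ≤ ‖(g' : Matrix n n ℂ) - (g : Matrix n n ℂ)‖ * ‖star (g : Matrix n n ℂ)‖ := norm_mul_le _ _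
      _ = _ := by rw [norm_star, CStarRing.norm_of_mem_unitary hgu, mul_one]
  · have h2 : (g' : Matrix n n ℂ) - (g : Matrix n n ℂ) =
        (((g' : Matrix n n ℂ) - (g : Matrix n n ℂ)) * star (g : Matrix n n ℂ)) * (g : Matrix n n ℂ) := by
      rw [mul_assoc, Unitary.star_mul_self_of_mem hgu, mul_one]
    calc ‖(g' : Matrix n n ℂ) - (g : Matrix n n ℂ)‖
        = ‖(((g' : Matrix n n ℂ) - (g : Matrix n n ℂ)) * star (g : Matrix n n ℂ)) * (g : Matrix n n ℂ)‖ := by rw [← h2]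
      _ ≤ ‖((g' : Matrix n n ℂ) - (g : Matrix n n ℂ)) * star (g : Matrix n n ℂ)‖ * ‖(g : Matrix n n ℂ)‖ := norm_mul_le _ _
      _ = _ := by rw [CStarRing.norm_of_mem_unitary hgu, mul_one]

/-- **THE CENTRE-LEG LAW IS INVERSE-LIPSCHITZ NEAR THE IDENTITY**: for a background `U₀` with loop variables at `c` within `α`, `κ = s′∕|I|`,
and `g, g′ ∈ SU(N)` with `α + dist1 g ≤ 1∕24`, `48ℓ‖g′g⁻¹ − 1‖ ≤ 1`, `2ℓ‖g′g⁻¹ − 1‖ + (α + dist1 g) < δ_N`,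
`800ℓ(ℓ‖g′g⁻¹ − 1‖ + α + dist1 g) ≤ κ`: `‖g′·g⁻¹ − 1‖ ≤ (2∕κ)·‖Ū(g′)·Ū(g)* − 1‖` (`Ū(g) = Ū(update U₀ e′ (g·U₀e′))(c)`).
[cite: Balaban1985Averaging, Prop. 3 (122)-(124) p.36] -/
theorem centreLeg_inverse_lipschitz [Nonempty n] (hj : j + 1 ≤ P.m + P.K)
    (U₀ : GaugeField P j (Matrix.specialUnitaryGroup n ℂ)) (c : PBond P (j + 1)) {ν : Fin P.d} (hν : ν ≠ c.dir)
    {α : ℝ} (hα : ∀ i, dist1 (loopHol U₀ c i) ≤ α) (κ : ℝ)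
    (hκ : κ = ((Fintype.card (Idx P) : ℝ))⁻¹ *
      ((Finset.univ.filter fun i : Idx P => (stairWord i.2.1 (off i.1)).head? = some (ν, true)).card : ℝ))
    (g g' : Matrix.specialUnitaryGroup n ℂ)
    (h24 : α + dist1 g ≤ 1 / 24)
    (h48 : 48 * ((((P.d + 2) * P.L : ℕ) : ℝ) * ‖(((g' * g⁻¹ : Matrix.specialUnitaryGroup n ℂ)) : Matrix n n ℂ) - 1‖) ≤ 1)
    (hN : 2 * ((((P.d + 2) * P.L : ℕ) : ℝ) * ‖(((g' * g⁻¹ : Matrix.specialUnitaryGroup n ℂ)) : Matrix n n ℂ) - 1‖) +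
      (α + dist1 g) < deltaSU n)
    (hD : 800 * (((P.d + 2) * P.L : ℕ) : ℝ) *
      ((((P.d + 2) * P.L : ℕ) : ℝ) * ‖(((g' * g⁻¹ : Matrix.specialUnitaryGroup n ℂ)) : Matrix n n ℂ) - 1‖ + (α + dist1 g)) ≤ κ) :
    ‖(((g' * g⁻¹ : Matrix.specialUnitaryGroup n ℂ)) : Matrix n n ℂ) - 1‖ ≤
      2 / κ * ‖((avgFun (expMeanLogSU (n := n)) (Function.update U₀ ⟨emb c.src, ν⟩ (g' * U₀ ⟨emb c.src, ν⟩)) c :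
              Matrix.specialUnitaryGroup n ℂ) : Matrix n n ℂ) *
            star ((avgFun (expMeanLogSU (n := n)) (Function.update U₀ ⟨emb c.src, ν⟩ (g * U₀ ⟨emb c.src, ν⟩)) c :
              Matrix.specialUnitaryGroup n ℂ) : Matrix n n ℂ) - 1‖ := by
  classical
  set ℓ : ℝ := (((P.d + 2) * P.L : ℕ) : ℝ) with hℓ
  set e : PBond P j := ⟨emb c.src, ν⟩ with he
  set h : Matrix.specialUnitaryGroup n ℂ := g' * g⁻¹ with hh
  set δ : ℝ := ‖((h : Matrix.specialUnitaryGroup n ℂ) : Matrix n n ℂ) - 1‖ with hδ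
  have hδ0 : 0 ≤ δ := norm_nonneg _
  have hℓ0 : 0 ≤ ℓ := Nat.cast_nonneg _
  have hκpos : 0 < κ := by
    have h1 := one_le_card_centreLeg (P := P) ν
    have hc : (0 : ℝ) < Fintype.card (Idx P) := Nat.cast_pos.mpr Fintype.card_pos
    rw [hκ]
    exact mul_pos (inv_pos.mpr hc) (by exact_mod_cast h1)
  -- the moved background
  set U₁ : GaugeField P j (Matrix.specialUnitaryGroup n ℂ) := Function.update U₀ e (g * U₀ e) with hU₁
  have hα₁ : ∀ i, dist1 (loopHol U₁ c i) ≤ α + dist1 g := fun i => by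
    rw [hU₁, he]
    have := dist1_loopHol_update_centreLeg_le hj U₀ c hν g i
    linarith [hα i]
  -- FILE B at `U₁` with perturbation `h`
  have key := centreLeg_response hj U₁ c hν hδ0 hα₁ h24 h48 hN h le_rfl
  have hupd : Function.update U₁ e (h * U₁ e) = Function.update U₀ e (g' * U₀ e) := by
    rw [hU₁, Function.update_self, Function.update_idem, hh, mul_assoc, inv_mul_cancel_left]
  rw [hupd, hU₁, he] at key
  have hcast : (((Fintype.card (Idx P) : ℂ))⁻¹ *
      ((Finset.univ.filter fun i : Idx P => (stairWord i.2.1 (off i.1)).head? = some (ν, true)).card : ℂ)) = ((κ : ℝ) : ℂ) := by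
    rw [hκ]; push_cast; rfl
  rw [hcast] at key
  -- `κδ ≤ ‖A − 1‖ + ε`
  set A : Matrix n n ℂ := ((avgFun (expMeanLogSU (n := n)) (Function.update U₀ ⟨emb c.src, ν⟩ (g' * U₀ ⟨emb c.src, ν⟩)) c :
        Matrix.specialUnitaryGroup n ℂ) : Matrix n n ℂ) *
      star ((avgFun (expMeanLogSU (n := n)) (Function.update U₀ ⟨emb c.src, ν⟩ (g * U₀ ⟨emb c.src, ν⟩)) c :
        Matrix.specialUnitaryGroup n ℂ) : Matrix n n ℂ) with hA
  have hκδ : κ * δ = ‖((κ : ℝ) : ℂ) • (((h : Matrix.specialUnitaryGroup n ℂ) : Matrix n n ℂ) - 1)‖ := by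
    rw [norm_smul, Complex.norm_real, Real.norm_of_nonneg hκpos.le, hδ]
  have htri : κ * δ ≤ ‖A - 1‖ + 400 * (ℓ * δ) * (ℓ * δ + (α + dist1 g)) := by
    rw [hκδ]
    have e1 : ((κ : ℝ) : ℂ) • (((h : Matrix.specialUnitaryGroup n ℂ) : Matrix n n ℂ) - 1) =
        (A - 1) - (A - 1 - ((κ : ℝ) : ℂ) • (((h : Matrix.specialUnitaryGroup n ℂ) : Matrix n n ℂ) - 1)) := by abel
    rw [e1]
    exact (norm_sub_le _ _).trans (add_le_add le_rfl key)
  -- absorb: `400ℓδ(ℓδ + α′) ≤ (κ/2)·δ`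
  have habs : 400 * (ℓ * δ) * (ℓ * δ + (α + dist1 g)) ≤ κ / 2 * δ := by
    have : 400 * ℓ * (ℓ * δ + (α + dist1 g)) ≤ κ / 2 := by linarith
    calc 400 * (ℓ * δ) * (ℓ * δ + (α + dist1 g)) = (400 * ℓ * (ℓ * δ + (α + dist1 g))) * δ := by ring
      _ ≤ κ / 2 * δ := mul_le_mul_of_nonneg_right this hδ0
  have hfin : κ / 2 * δ ≤ ‖A - 1‖ := by linarith
  calc δ = 2 / κ * (κ / 2 * δ) := by field_simp
    _ ≤ 2 / κ * ‖A - 1‖ := mul_le_mul_of_nonneg_left hfin (by positivity)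

/-- **INJECTIVITY OF THE CENTRE-LEG LAW NEAR THE IDENTITY**: under the smallness of `centreLeg_inverse_lipschitz`, equal averages force
equal centre-leg values. [cite: Balaban1985Averaging, Prop. 3 (122)-(124) p.36] -/
theorem centreLeg_injective [Nonempty n] (hj : j + 1 ≤ P.m + P.K)
    (U₀ : GaugeField P j (Matrix.specialUnitaryGroup n ℂ)) (c : PBond P (j + 1)) {ν : Fin P.d} (hν : ν ≠ c.dir)
    {α : ℝ} (hα : ∀ i, dist1 (loopHol U₀ c i) ≤ α) (κ : ℝ)
    (hκ : κ = ((Fintype.card (Idx P) : ℝ))⁻¹ *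
      ((Finset.univ.filter fun i : Idx P => (stairWord i.2.1 (off i.1)).head? = some (ν, true)).card : ℝ))
    (g g' : Matrix.specialUnitaryGroup n ℂ)
    (h24 : α + dist1 g ≤ 1 / 24)
    (h48 : 48 * ((((P.d + 2) * P.L : ℕ) : ℝ) * ‖(((g' * g⁻¹ : Matrix.specialUnitaryGroup n ℂ)) : Matrix n n ℂ) - 1‖) ≤ 1)
    (hN : 2 * ((((P.d + 2) * P.L : ℕ) : ℝ) * ‖(((g' * g⁻¹ : Matrix.specialUnitaryGroup n ℂ)) : Matrix n n ℂ) - 1‖) +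
      (α + dist1 g) < deltaSU n)
    (hD : 800 * (((P.d + 2) * P.L : ℕ) : ℝ) *
      ((((P.d + 2) * P.L : ℕ) : ℝ) * ‖(((g' * g⁻¹ : Matrix.specialUnitaryGroup n ℂ)) : Matrix n n ℂ) - 1‖ + (α + dist1 g)) ≤ κ)
    (heq : avgFun (expMeanLogSU (n := n)) (Function.update U₀ ⟨emb c.src, ν⟩ (g' * U₀ ⟨emb c.src, ν⟩)) c =
      avgFun (expMeanLogSU (n := n)) (Function.update U₀ ⟨emb c.src, ν⟩ (g * U₀ ⟨emb c.src, ν⟩)) c) :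
    g' = g := by
  have key := centreLeg_inverse_lipschitz hj U₀ c hν hα κ hκ g g' h24 h48 hN hD
  rw [heq] at key
  have hKu : ((avgFun (expMeanLogSU (n := n)) (Function.update U₀ ⟨emb c.src, ν⟩ (g * U₀ ⟨emb c.src, ν⟩)) c :
      Matrix.specialUnitaryGroup n ℂ) : Matrix n n ℂ) ∈ Matrix.unitaryGroup n ℂ :=
    (Matrix.mem_specialUnitaryGroup_iff.1 (avgFun (expMeanLogSU (n := n)) _ c).2).1
  rw [Unitary.mul_star_self_of_mem hKu, sub_self, norm_zero, mul_zero] at key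
  have h0 : ‖(((g' * g⁻¹ : Matrix.specialUnitaryGroup n ℂ)) : Matrix n n ℂ) - 1‖ = 0 := le_antisymm key (norm_nonneg _)
  rw [norm_mul_inv_sub_one, norm_eq_zero, sub_eq_zero] at h0
  exact Subtype.ext h0

end Summit.QuantumFields.YangMills.Theorems.FluctuationComparisonRegPrIntLS1aCentreLegInverseLipschitz

end
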